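import Literature.NumberTheory.EllipticCurves.ZpExtensionEisensteinDVRSettingH4AnnSatProofs
import Literature.NumberTheory.EllipticCurves.ZpExtensionEisensteinDVRSettingH4RestrictedFlipAdjointProofs
import Literature.NumberTheory.EllipticCurves.ZpExtensionEisensteinTwistFreeProofs
import HarnessLib

/-!
# (ANN-SAT) at `v ∣ p` for the curve's Eisenstein setting, `X`-side: a compatible family of `H¹(K_v, T^{(j)})`
# orthogonal to the transported saturated ordinary condition is saturated for the ordinary cores (theorems only)

`Proofs` file (theorems only; no definition, no named fact, no instance, no notation, no `sorry`).  Topic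
`NumberTheory/EllipticCurves` (D1 road of cell `pub/bsd-print-x9`; shared μ-crux `MuInequalityCoherentPairOfPrint`
(stmt-BirchSwinnertonDyer-23237), STUB A field `SatisfiesH.h4` / `Stmt.h4AtS` at the places `v ∣ p`; brick (B6) of the
memo `HOME/p1/H4-EXACT-AT-P-PLAN-x10b-p1-g8.md`).  The `X/Y`-FLIPPED twin of
`ZpExtensionEisensteinDVRSettingH4AnnSatProofs` (the `Y`-side): the annihilator half of the SECOND (Exact) binder
(`hExactX`) of the abstract descent `Tower.levelCondition_mem_iff_forall_pairing_eq_zero` at `v ∣ p`: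

  (ANN-SAT-X) every COMPATIBLE family `ξ` of `X_j = H¹(K_v, T^{(j)})` with `B_j (ξ_j, η_j) = 0` for all families `η` of
  `Y_j = H¹(K_v, Tw T^{(j)})` saturated for the TRANSPORTED ordinary cores and all `j` is saturated for the strict
  ordinary cores at `v`.

Same proof as the `Y`-side with the roles of the two towers exchanged (pairing `B_j.flip`): the restricted pair is now
`F_j = H¹(K_v, δ_v·Fil_{σv} W_{j+1} ≤ Tw W_{j+1})` (reductions: x10b-p1-w6's `subFamily` of the twisted presented family)
and `G_j = H¹(K_v, W_{j+1} ⧸ Fil_v W_{j+1})` (divisions: `quotFamily` of the plain presented family), paired by the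
FLIPPED restricted pairings `P♭_j : (T^{(j)} ⧸ Fil_v) × δ_v Fil_{σv} → A_{m,j+1}(1)` of x10b-p1-w7
(`DualityDatum.exists_restrictedPairing_flip` / `WeierstrassCurve.eisensteinTower_restrictedPairing_flip_nondegenerate`,
taken as HYPOTHESES `P, hP, hPnd`); (proj) by `ContPairing.cupProduct_adjoint` for `(mkQ, subtype)`; (Adj′) = x10b-p1-w7's
`eisensteinTower_restrictedPairing_flip_cupProduct_adjoint'`; (core) for `F` via `ConjugationDatum.map_transportH1_strictSubgroup_eq`;
(ker) for `G` is the definition of the strict core; (Ker-tors) for `G` from the short exact sequences of the plain quotient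
family and x10b-p1-w5's (B4) `OrdinaryFiltration.natCast_smul_eq_zero_of_forall_quotient_apply_eq_self` (`p · H⁰(K_v,
W_d ⧸ Fil_v W_d) = 0` given `g₀ ∈ Γ_{K_v}` with `κ(g₀) = p^s`, `2p^s < m`).
HONEST FRAMING: the ordinary structure at `v` and `σ•v`, the flipped restricted pairings and the element `g₀` are hypotheses,
discharged by the D1 assembly; no summit statement is proved; BSD is not proved by any of this.

References: B. Howard, Compositio Math. 140 (2004), §1.3 H.4, §1.6, Lemma 3.1.1, Def. 3.2.5–3.2.6 (arXiv:1202.6340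
p. 7 L78–82, p. 11–12, p. 15–16); J. S. Milne, *Arithmetic Duality Theorems* (2006), I §0 Prop. 0.19, I Cor. 2.3;
B. Mazur, K. Rubin, Mem. AMS 799 (2004), §1.3; J.-P. Serre, *Galois Cohomology* (1997), I §2.2, §2.4; R. Greenberg,
LNM 1716 (1999), §2.
-/

set_option autoImplicit false

noncomputable section

open Function NumberField IsDedekindDomain Field CategoryTheory
open scoped NumberField ContRepresentation

namespace WeierstrassCurve

open Literature.NumberTheory.EllipticCurves Literature.NumberTheory.GaloisRepresentations
open Literature.NumberTheory.GaloisRepresentations.DiscreteGaloisModule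
open Literature.NumberTheory.GaloisCohomology Literature.NumberTheory.GaloisCohomology.Howard2004
open Literature.NumberTheory.EllipticCurves.ZpExtension (EisensteinLevel)

variable {K : Type} [Field K] [NumberField K] (W : WeierstrassCurve ℚ) [W.IsElliptic] {p : ℕ} [hp : Fact p.Prime]
  (κ : ZpExtension K p) {m : ℕ} (hm : 1 ≤ m) (cd : ConjugationDatum K)
  (D : letI := IwasawaAlgebra.isLocalRing_quotient_X_pow_add_C p hm
    ∀ k, DualityDatum p cd ((W.eisensteinTower κ hm).ρ k) (IwasawaAlgebra.EisensteinCoeff p m (k + 1)))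

set_option maxHeartbeats 1000000 in
/-- **(ANN-SAT) at `v ∣ p` for the curve's Eisenstein setting, `X`-side.**  For `T := W.eisensteinTower κ hm`, H.4 data
`D` with `he_red`, a place `v` with ordinary structure at `v` and at `σ•v`, FLIPPED restricted pairings
`P♭_j : T^{(j)} ⧸ Fil_v T^{(j)} × δ_v Fil_{σv} T^{(j)} → A_{m,j+1}(1)` with `P♭_j ([s], t) = e_j (s, t)` and left-non-degenerate
cup products, and `g₀ ∈ Γ_{K_v}` with `κ(g₀) = p^s`, `2p^s < m`: every compatible family `ξ` of `(H¹(K_v, T^{(j)}))_j` with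
`(ξ_j ∪ η_j) = 0` for all families `η` saturated for the transported strict ordinary cores and all `j` is saturated for the
strict ordinary cores at `v` — the annihilator half of the `X`-side (Exact) of `Tower.levelCondition_mem_iff_forall_pairing_eq_zero`.
[cite: Howard2004HeegnerKolyvagin, §1.3 H.4, Lemma 3.1.1 and Def. 3.2.6 (arXiv p. 7 L78–82, p. 15–16)]
[cite: MilneADT2006, Ch. I Cor. 2.3 and Thm. 2.6] [cite: MazurRubinMemoirs2004, §1.3] -/
theorem eisensteinTower_mem_saturatedFamilies_of_forall_localCup_flip_eq_zero
    (he_red : letI := IwasawaAlgebra.isLocalRing_quotient_X_pow_add_C p hm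
      ∀ k (x y : EisensteinLevel p m (fun j ↦ geomTorsion (W.baseChange K) ((p : ℤ) ^ j)) (k + 1 + 1)),
        IwasawaAlgebra.EisensteinCoeff.reduce p m (Nat.le_succ (k + 1)) ((D (k + 1)).e x y) =
          (D k).e ((W.eisensteinTower κ hm).red k x) ((W.eisensteinTower κ hm).red k y))
    {v : HeightOneSpectrum (𝓞 K)} [CharZero (v.adicCompletion K)]
    (hgood : (W.baseChange K).HasGoodReductionAt v) (hpv : ((p : ℕ) : 𝓞 K) ∈ v.asIdeal)
    (hord : ∃ P : localPoints (W.baseChange K) (v.adicCompletion K),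
      (p : ℤ) • P = 0 ∧ P ∉ (W.baseChange K).localKernelOfReduction v)
    (hgoodσ : (W.baseChange K).HasGoodReductionAt (cd.σ • v)) (hpσv : ((p : ℕ) : 𝓞 K) ∈ (cd.σ • v).asIdeal)
    (hordσ : ∃ P : localPoints (W.baseChange K) ((cd.σ • v).adicCompletion K),
      (p : ℤ) • P = 0 ∧ P ∉ (W.baseChange K).localKernelOfReduction (cd.σ • v))
    (P : letI := IwasawaAlgebra.isLocalRing_quotient_X_pow_add_C p hm
      ∀ j, ContPairing
        ((GaloisRep.toLocal v ((W.eisensteinTower κ hm).ρ j)).quotient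
          (((W.baseChange K).ordinaryFiltrationAt v (fun j ↦ (W.baseChange K).torsionGaloisModuleReduce p j)
            (fun _ _ ↦ rfl)).twistedFil (p := p) (m := m) (j + 1))
          (((W.baseChange K).ordinaryFiltrationAt v (fun j ↦ (W.baseChange K).torsionGaloisModuleReduce p j)
            (fun _ _ ↦ rfl)).twistedFil_le_comap (κ := κ) hm (j + 1))).toTopRep
        ((GaloisRep.toLocal v (cd.twist ((W.eisensteinTower κ hm).ρ j))).subrepresentation
          ((((W.baseChange K).ordinaryFiltrationAt (cd.σ • v) (fun j ↦ (W.baseChange K).torsionGaloisModuleReduce p j)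
            (fun _ _ ↦ rfl)).twistedFil (p := p) (m := m) (j + 1)).map (((W.eisensteinTower κ hm).ρ j) (cd.δ v)))
          (cd.map_delta_le_comap_twist ((W.eisensteinTower κ hm).ρ j) v _ fun g ↦
            ((W.baseChange K).ordinaryFiltrationAt (cd.σ • v) (fun j ↦ (W.baseChange K).torsionGaloisModuleReduce p j)
              (fun _ _ ↦ rfl)).twistedFil_le_comap (κ := κ) hm (j + 1) g)).toTopRep
        (GaloisRep.toLocal v (D j).twistOne).toTopRep)
    (hP : letI := IwasawaAlgebra.isLocalRing_quotient_X_pow_add_C p hm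
      ∀ (j : ℕ) (s : EisensteinLevel p m (fun j ↦ geomTorsion (W.baseChange K) ((p : ℤ) ^ j)) (j + 1))
        (t : ((((W.baseChange K).ordinaryFiltrationAt (cd.σ • v) (fun j ↦ (W.baseChange K).torsionGaloisModuleReduce p j)
            (fun _ _ ↦ rfl)).twistedFil (p := p) (m := m) (j + 1)).map (((W.eisensteinTower κ hm).ρ j) (cd.δ v)))),
        (P j).toLin (Submodule.Quotient.mk s) t = (D j).e s (t : _))
    (hPnd : letI := IwasawaAlgebra.isLocalRing_quotient_X_pow_add_C p hm
      ∀ (j : ℕ) (x : galoisCohomology ((GaloisRep.toLocal v ((W.eisensteinTower κ hm).ρ j)).quotient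
          (((W.baseChange K).ordinaryFiltrationAt v (fun j ↦ (W.baseChange K).torsionGaloisModuleReduce p j)
            (fun _ _ ↦ rfl)).twistedFil (p := p) (m := m) (j + 1))
          (((W.baseChange K).ordinaryFiltrationAt v (fun j ↦ (W.baseChange K).torsionGaloisModuleReduce p j)
            (fun _ _ ↦ rfl)).twistedFil_le_comap (κ := κ) hm (j + 1))) 1),
        (∀ y, (P j).cupProduct x y = 0) → x = 0)
    {g₀ : absoluteGaloisGroup (v.adicCompletion K)} {s : ℕ}
    (hg₀ : (κ (absGaloisRestrict K (v.adicCompletion K) g₀)).toAdd = ((p ^ s : ℕ) : ℤ_[p]))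
    (hms : 2 * p ^ s < m)
    {ξ : letI := IwasawaAlgebra.isLocalRing_quotient_X_pow_add_C p hm
      Π j, galoisCohomology (((W.eisensteinTower κ hm).ρ j).toLocal (Sum.inr v)) 1}
    (hξ : letI := IwasawaAlgebra.isLocalRing_quotient_X_pow_add_C p hm
      ξ ∈ Tower.compatibleFamilies
        (H := fun j ↦ galoisCohomology (((W.eisensteinTower κ hm).ρ j).toLocal (Sum.inr v)) 1)
        (fun j ↦ ContinuousRep.cohomologyMap (((W.eisensteinTower κ hm).ρ (j + 1)).toLocal (Sum.inr v))
          (((W.eisensteinTower κ hm).ρ j).toLocal (Sum.inr v)) ((W.eisensteinTower κ hm).red j).toAddMonoidHom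
          continuous_of_discreteTopology (fun _ z => (W.eisensteinTower κ hm).red_equivariant j _ z) 1))
    (h0 : letI := IwasawaAlgebra.isLocalRing_quotient_X_pow_add_C p hm
      ∀ (j : ℕ), ∀ η ∈ Tower.saturatedFamilies
        (H := fun j ↦ galoisCohomology ((cd.twist ((W.eisensteinTower κ hm).ρ j)).toLocal (Sum.inr v)) 1)
        (fun j ↦ ContinuousRep.cohomologyMap ((cd.twist ((W.eisensteinTower κ hm).ρ (j + 1))).toLocal (Sum.inr v))
          ((cd.twist ((W.eisensteinTower κ hm).ρ j)).toLocal (Sum.inr v)) ((W.eisensteinTower κ hm).red j).toAddMonoidHom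
          continuous_of_discreteTopology (fun _ z => (W.eisensteinTower κ hm).red_equivariant j _ z) 1) p
        (fun j ↦ (((W.baseChange K).ordinaryFiltrationAt (cd.σ • v)
            (fun j ↦ (W.baseChange K).torsionGaloisModuleReduce p j) (fun _ _ ↦ rfl)).ordinaryCore hm (j + 1)).map
          (cd.transportH1 (κ.eisensteinTwist ((W.baseChange K).torsionGaloisModule ((p : ℤ) ^ (j + 1))) hm (j + 1)) v)),
        (D j).localCup (Sum.inr v) (ξ j) (η j) = 0) :
    letI := IwasawaAlgebra.isLocalRing_quotient_X_pow_add_C p hm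
    ξ ∈ Tower.saturatedFamilies
      (H := fun j ↦ galoisCohomology (((W.eisensteinTower κ hm).ρ j).toLocal (Sum.inr v)) 1)
      (fun j ↦ ContinuousRep.cohomologyMap (((W.eisensteinTower κ hm).ρ (j + 1)).toLocal (Sum.inr v))
        (((W.eisensteinTower κ hm).ρ j).toLocal (Sum.inr v)) ((W.eisensteinTower κ hm).red j).toAddMonoidHom
        continuous_of_discreteTopology (fun _ z => (W.eisensteinTower κ hm).red_equivariant j _ z) 1) p
      (fun j ↦ ((W.baseChange K).ordinaryFiltrationAt v (fun j ↦ (W.baseChange K).torsionGaloisModuleReduce p j)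
        (fun _ _ ↦ rfl)).ordinaryCore hm (j + 1)) := by
  letI := IwasawaAlgebra.isLocalRing_quotient_X_pow_add_C p hm
  have hpp := hp.out
  have hpK : (p : K) ≠ 0 := by exact_mod_cast hpp.ne_zero
  -- finiteness of the levels
  haveI hfinM : ∀ j, Finite (EisensteinLevel p m (fun j ↦ geomTorsion (W.baseChange K) ((p : ℤ) ^ j)) j) := fun j ↦ by
    haveI : Finite (geomTorsion (W.baseChange K) ((p : ℤ) ^ j)) :=
      finite_torsionPoints_holds (W.baseChange K) (AlgebraicClosure K) (n := (p : ℤ) ^ j)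
        (pow_ne_zero _ (by exact_mod_cast hpp.ne_zero))
    exact IwasawaAlgebra.EisensteinCoeff.finite_twisted (p := p) (k := j)
      (M := geomTorsion (W.baseChange K) ((p : ℤ) ^ j)) hm
  /- ### A. the plain local presented family at `v` (levels `a ≥ 0`, `W_a = E_K[p^a] ⊗ A_{m,a}(ψ)`) -/
  let Fam : ∀ a b, (κ.eisensteinTwist ((W.baseChange K).torsionGaloisModule ((p : ℤ) ^ a)) hm a).toContRepresentation →ⁱL
      (κ.eisensteinTwist ((W.baseChange K).torsionGaloisModule ((p : ℤ) ^ b)) hm b).toContRepresentation :=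
    fun a b ↦ (W.baseChange K).eisensteinTwistTorsionTransfer κ hm
      (fun j ↦ (W.baseChange K).torsionGaloisModuleReduce p j) (W.torsionGaloisModuleReduce_coe (K := K) (p := p)) a b
  let ρloc : ∀ a, DiscreteGaloisModule (v.adicCompletion K)
      (EisensteinLevel p m (fun j ↦ geomTorsion (W.baseChange K) ((p : ℤ) ^ j)) a) :=
    fun a ↦ (κ.eisensteinTwist ((W.baseChange K).torsionGaloisModule ((p : ℤ) ^ a)) hm a).toLocal (Sum.inr v)
  let floc : ∀ a b, (ρloc a).toContRepresentation →ⁱL (ρloc b).toContRepresentation :=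
    fun a b ↦ Literature.NumberTheory.EllipticCurves.DiscreteGaloisModule.localMap (Fam a b) (Sum.inr v)
  have hid : ∀ a (x : EisensteinLevel p m (fun j ↦ geomTorsion (W.baseChange K) ((p : ℤ) ^ j)) a), floc a a x = x :=
    fun a x ↦ κ.eisensteinTwistTransfer_self (fun k ↦ (W.baseChange K).torsionGaloisModule ((p : ℤ) ^ k))
      (fun j ↦ (W.baseChange K).torsionGaloisModuleReduce p j) hm _ _ _ a x
  have hcomp : ∀ a b c', c' ≤ b → b ≤ a →
      ∀ x : EisensteinLevel p m (fun j ↦ geomTorsion (W.baseChange K) ((p : ℤ) ^ j)) a, floc b c' (floc a b x) = floc a c' x :=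
    fun a b c' hcb hba x ↦ κ.eisensteinTwistTransfer_comp (fun k ↦ (W.baseChange K).torsionGaloisModule ((p : ℤ) ^ k))
      (fun j ↦ (W.baseChange K).torsionGaloisModuleReduce p j) hm _ _ _ hcb hba x
  have hsurj : ∀ ℓ n, Function.Surjective (floc (ℓ + n) n) :=
    fun ℓ n ↦ κ.eisensteinTwistTransfer_surjective_of_le (fun k ↦ (W.baseChange K).torsionGaloisModule ((p : ℤ) ^ k))
      (fun j ↦ (W.baseChange K).torsionGaloisModuleReduce p j) hm _ _ _ (Nat.le_add_left n ℓ)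
  have hex : ∀ ℓ n (y : EisensteinLevel p m (fun j ↦ geomTorsion (W.baseChange K) ((p : ℤ) ^ j)) (ℓ + n)),
      floc (ℓ + n) n y = 0 ↔ ∃ x, floc ℓ (ℓ + n) x = y :=
    fun ℓ n y ↦ κ.eisensteinTwistTransfer_eq_zero_iff_exists (fun k ↦ (W.baseChange K).torsionGaloisModule ((p : ℤ) ^ k))
      (fun j ↦ (W.baseChange K).torsionGaloisModuleReduce p j) hm _ _ _ ℓ n y
  /- ### B. the sub-tower `Fil_v W_a` at `v` and its `H¹` (the `F`-tower) -/
  let Fil : ∀ a, Submodule ℤ (EisensteinLevel p m (fun j ↦ geomTorsion (W.baseChange K) ((p : ℤ) ^ j)) a) := fun a ↦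
    ((W.baseChange K).ordinaryFiltrationAt v (fun j ↦ (W.baseChange K).torsionGaloisModuleReduce p j)
      (fun _ _ ↦ rfl)).twistedFil (p := p) (m := m) a
  have hΓ : ∀ a (σ : absoluteGaloisGroup (v.adicCompletion K)), Fil a ≤ (Fil a).comap (ρloc a σ) := fun a σ ↦
    ((W.baseChange K).ordinaryFiltrationAt v (fun j ↦ (W.baseChange K).torsionGaloisModuleReduce p j)
      (fun _ _ ↦ rfl)).twistedFil_le_comap (κ := κ) hm a σ
  have hmapv : ∀ a b, ∀ w ∈ Fil a, floc a b w ∈ Fil b := fun a b w hw ↦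
    (W.baseChange K).eisensteinTwistTransfer_mem_twistedFil_ordinaryFiltrationAt v κ hm hgood hpv hord
      (fun j ↦ (W.baseChange K).torsionGaloisModuleReduce p j) (fun _ _ ↦ rfl) a b w hw
  obtain ⟨g, hg⟩ := Tower.exists_subFamily_apply_eq ρloc floc Fil hΓ hmapv
  -- the `F`-tower (D-indexed: level `j ↦ Fil_v W_{j+1}`), its reductions and the inclusions `ι_j = H¹(subtype)`
  let ρF : ∀ j, DiscreteGaloisModule (v.adicCompletion K) (Fil (j + 1)) :=
    fun j ↦ (ρloc (j + 1)).subrepresentation (Fil (j + 1)) (hΓ (j + 1))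
  haveI hfinF : ∀ j, Finite (galoisCohomology (ρF j) 1) := fun j ↦
    finite_galoisCohomology_one_adicCompletion v (ρF j)
  let redF : ∀ j, galoisCohomology (ρF (j + 1)) 1 →+ galoisCohomology (ρF j) 1 :=
    fun j ↦ galoisCohomology.map (g (j + 1 + 1) (j + 1)) 1
  let ι : ∀ j, galoisCohomology (ρF j) 1 →+ galoisCohomology (((W.eisensteinTower κ hm).ρ j).toLocal (Sum.inr v)) 1 :=
    fun j ↦ (cohomologyMap (subtypeHom (ρloc (j + 1)) (Fil (j + 1)) (hΓ (j + 1))) 1).hom.toLinearMap.toAddMonoidHom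
  have hιdef : ∀ j (f : galoisCohomology (ρF j) 1),
      ι j f = cohomologyMap (subtypeHom (ρloc (j + 1)) (Fil (j + 1)) (hΓ (j + 1))) 1 f := fun j f ↦ rfl
  -- the reductions of the `D`-indexed tower are `H¹(floc (j+2) (j+1))`
  have hred : ∀ (j : ℕ) (x : galoisCohomology (((W.eisensteinTower κ hm).ρ (j + 1)).toLocal (Sum.inr v)) 1),
      ContinuousRep.cohomologyMap (((W.eisensteinTower κ hm).ρ (j + 1)).toLocal (Sum.inr v))
          (((W.eisensteinTower κ hm).ρ j).toLocal (Sum.inr v)) ((W.eisensteinTower κ hm).red j).toAddMonoidHom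
          continuous_of_discreteTopology (fun _ z => (W.eisensteinTower κ hm).red_equivariant j _ z) 1 x =
        galoisCohomology.map (floc (j + 1 + 1) (j + 1)) 1 x := by
    intro j x
    have e1 : floc (j + 1 + 1) (j + 1) = Literature.NumberTheory.EllipticCurves.DiscreteGaloisModule.localMap
        (κ.eisensteinTwistReduce hm (Nat.le_succ (j + 1)) ((W.baseChange K).torsionGaloisModuleReduce p (j + 1)))
        (Sum.inr v) := by
      change Literature.NumberTheory.EllipticCurves.DiscreteGaloisModule.localMap (κ.eisensteinTwistTransfer
        (fun k ↦ (W.baseChange K).torsionGaloisModule ((p : ℤ) ^ k))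
        (fun j ↦ (W.baseChange K).torsionGaloisModuleReduce p j) hm _ _ _ (j + 1 + 1) (j + 1)) (Sum.inr v) = _
      rw [κ.eisensteinTwistTransfer_succ_self]
    rw [e1]
    rfl
  have hι : ∀ (j : ℕ) (f : galoisCohomology (ρF (j + 1)) 1),
      ContinuousRep.cohomologyMap (((W.eisensteinTower κ hm).ρ (j + 1)).toLocal (Sum.inr v))
          (((W.eisensteinTower κ hm).ρ j).toLocal (Sum.inr v)) ((W.eisensteinTower κ hm).red j).toAddMonoidHom
          continuous_of_discreteTopology (fun _ z => (W.eisensteinTower κ hm).red_equivariant j _ z) 1 (ι (j + 1) f) =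
        ι j (redF j f) := by
    intro j f
    rw [hred, hιdef, hιdef]
    exact Tower.map_subtypeHom_eq_subtypeHom_map (ρ := ρloc) (f := floc) (Fil := Fil) (hΓ := hΓ) hg
      (j + 1 + 1) (j + 1) f
  have hC : ∀ (j : ℕ) (f : galoisCohomology (ρF j) 1),
      ι j f ∈ ((W.baseChange K).ordinaryFiltrationAt v (fun j ↦ (W.baseChange K).torsionGaloisModuleReduce p j)
        (fun _ _ ↦ rfl)).ordinaryCore hm (j + 1) := fun j f ↦
    (Tower.mem_strictSubgroup_iff_exists_map_subtypeHom_eq (ρ := ρloc) (Fil := Fil) (hΓ := hΓ) (j + 1) _).2 ⟨f, rfl⟩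
  /- ### C. the twisted quotient tower `Tw W_a ⧸ δ_v·Fil_{σv} W_a` at `v` (the `G`-tower) and (Ker-tors) -/
  let Filσ : ∀ a, Submodule ℤ (EisensteinLevel p m (fun j ↦ geomTorsion (W.baseChange K) ((p : ℤ) ^ j)) a) := fun a ↦
    ((W.baseChange K).ordinaryFiltrationAt (cd.σ • v) (fun j ↦ (W.baseChange K).torsionGaloisModuleReduce p j)
      (fun _ _ ↦ rfl)).twistedFil (p := p) (m := m) a
  let Fil' : ∀ a, Submodule ℤ (EisensteinLevel p m (fun j ↦ geomTorsion (W.baseChange K) ((p : ℤ) ^ j)) a) := fun a ↦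
    (Filσ a).map ((κ.eisensteinTwist ((W.baseChange K).torsionGaloisModule ((p : ℤ) ^ a)) hm a) (cd.δ v))
  let ρ'loc : ∀ a, DiscreteGaloisModule (v.adicCompletion K)
      (EisensteinLevel p m (fun j ↦ geomTorsion (W.baseChange K) ((p : ℤ) ^ j)) a) :=
    fun a ↦ (cd.twist (κ.eisensteinTwist ((W.baseChange K).torsionGaloisModule ((p : ℤ) ^ a)) hm a)).toLocal (Sum.inr v)
  have hΓ' : ∀ a (σ : absoluteGaloisGroup (v.adicCompletion K)), Fil' a ≤ (Fil' a).comap (ρ'loc a σ) := fun a σ ↦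
    cd.map_delta_le_comap_twist (κ.eisensteinTwist ((W.baseChange K).torsionGaloisModule ((p : ℤ) ^ a)) hm a) v (Filσ a)
      (fun g ↦ ((W.baseChange K).ordinaryFiltrationAt (cd.σ • v) (fun j ↦ (W.baseChange K).torsionGaloisModuleReduce p j)
        (fun _ _ ↦ rfl)).twistedFil_le_comap (κ := κ) hm a g) σ
  let f'loc : ∀ a b, (ρ'loc a).toContRepresentation →ⁱL (ρ'loc b).toContRepresentation :=
    fun a b ↦ Literature.NumberTheory.EllipticCurves.DiscreteGaloisModule.localMap
      (Literature.NumberTheory.EllipticCurves.DiscreteGaloisModule.restrictMap (Fam a b) cd.conj) (Sum.inr v)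
  have hf'loc : ∀ a b (x : EisensteinLevel p m (fun j ↦ geomTorsion (W.baseChange K) ((p : ℤ) ^ j)) a),
      f'loc a b x = Fam a b x := fun a b x ↦ rfl
  -- the translate by `δ_v` commutes with the family (equivariance for the global element `δ_v`)
  have hδFam : ∀ a b (x : EisensteinLevel p m (fun j ↦ geomTorsion (W.baseChange K) ((p : ℤ) ^ j)) a),
      Fam a b ((κ.eisensteinTwist ((W.baseChange K).torsionGaloisModule ((p : ℤ) ^ a)) hm a) (cd.δ v) x) =
        (κ.eisensteinTwist ((W.baseChange K).torsionGaloisModule ((p : ℤ) ^ b)) hm b) (cd.δ v) (Fam a b x) :=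
    fun a b x ↦ (Fam a b).isIntertwining (cd.δ v) x
  -- (hmapσ)/(ONTO)/(SAT) at `σ•v` for the plain family
  have hmapσ : ∀ a b, ∀ w ∈ Filσ a, Fam a b w ∈ Filσ b := fun a b w hw ↦
    (W.baseChange K).eisensteinTwistTransfer_mem_twistedFil_ordinaryFiltrationAt (cd.σ • v) κ hm hgoodσ hpσv hordσ
      (fun j ↦ (W.baseChange K).torsionGaloisModuleReduce p j) (fun _ _ ↦ rfl) a b w hw
  have hontoσ : ∀ ℓ n, ∀ w' ∈ Filσ n, ∃ w ∈ Filσ (ℓ + n), Fam (ℓ + n) n w = w' := fun ℓ n w' hw' ↦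
    (W.baseChange K).exists_mem_twistedFil_transfer_eq_ordinaryFiltrationAt (cd.σ • v) κ hm
      (fun j ↦ (W.baseChange K).torsionGaloisModuleReduce p j) (fun _ _ ↦ rfl) hgoodσ hpσv hordσ ℓ n w' hw'
  have hsatσ : ∀ ℓ n (w : EisensteinLevel p m (fun j ↦ geomTorsion (W.baseChange K) ((p : ℤ) ^ j)) ℓ),
      Fam ℓ (ℓ + n) w ∈ Filσ (ℓ + n) → w ∈ Filσ ℓ := fun ℓ n w hw ↦
    (W.baseChange K).mem_twistedFil_of_transfer_mem_ordinaryFiltrationAt (cd.σ • v) κ hm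
      (fun j ↦ (W.baseChange K).torsionGaloisModuleReduce p j) (fun _ _ ↦ rfl) hgoodσ hpσv hordσ ℓ n w hw
  -- the same for the translates `Fil'` and the twisted family `f'loc`
  have hmap' : ∀ a b, ∀ w ∈ Fil' a, f'loc a b w ∈ Fil' b := by
    rintro a b _ ⟨x, hx, rfl⟩
    exact ⟨Fam a b x, hmapσ a b x hx, (hδFam a b x).symm⟩
  have honto' : ∀ ℓ n, ∀ w' ∈ Fil' n, ∃ w ∈ Fil' (ℓ + n), f'loc (ℓ + n) n w = w' := by
    rintro ℓ n _ ⟨x, hx, rfl⟩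
    obtain ⟨w, hw, hwx⟩ := hontoσ ℓ n x hx
    exact ⟨_, ⟨w, hw, rfl⟩, (hδFam (ℓ + n) n w).trans (congrArg _ hwx)⟩
  have hδinj : ∀ a, Function.Injective
      ((κ.eisensteinTwist ((W.baseChange K).torsionGaloisModule ((p : ℤ) ^ a)) hm a) (cd.δ v)) := fun a x y hxy ↦ by
    have h := congrArg ((κ.eisensteinTwist ((W.baseChange K).torsionGaloisModule ((p : ℤ) ^ a)) hm a) (cd.δ v)⁻¹) hxy
    rwa [← Module.End.mul_apply, ← Module.End.mul_apply, ← map_mul, inv_mul_cancel, map_one,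
      Module.End.one_apply, Module.End.one_apply] at h
  have hδsurj : ∀ a, Function.Surjective
      ((κ.eisensteinTwist ((W.baseChange K).torsionGaloisModule ((p : ℤ) ^ a)) hm a) (cd.δ v)) := fun a y ↦
    ⟨(κ.eisensteinTwist ((W.baseChange K).torsionGaloisModule ((p : ℤ) ^ a)) hm a) (cd.δ v)⁻¹ y, by
      rw [← Module.End.mul_apply, ← map_mul, mul_inv_cancel, map_one, Module.End.one_apply]⟩
  have hsat' : ∀ ℓ n (w : EisensteinLevel p m (fun j ↦ geomTorsion (W.baseChange K) ((p : ℤ) ^ j)) ℓ),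
      f'loc ℓ (ℓ + n) w ∈ Fil' (ℓ + n) → w ∈ Fil' ℓ := by
    intro ℓ n w hw
    obtain ⟨w₀, rfl⟩ := hδsurj ℓ w
    rw [hf'loc, hδFam] at hw
    obtain ⟨y, hy, hyw⟩ := hw
    have hy' : Fam ℓ (ℓ + n) w₀ ∈ Filσ (ℓ + n) := by rw [← hδinj _ hyw]; exact hy
    exact ⟨w₀, hsatσ ℓ n w₀ hy', rfl⟩
  have hfloc : ∀ a b (x : EisensteinLevel p m (fun j ↦ geomTorsion (W.baseChange K) ((p : ℤ) ^ j)) a),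
      floc a b x = Fam a b x := fun a b x ↦ rfl
  have hsurj' : ∀ ℓ n, Function.Surjective (f'loc (ℓ + n) n) := by
    intro ℓ n y
    obtain ⟨x, hx⟩ := hsurj ℓ n y
    refine ⟨x, ?_⟩
    rw [hf'loc, ← hfloc]
    exact hx
  have hex' : ∀ ℓ n (y : EisensteinLevel p m (fun j ↦ geomTorsion (W.baseChange K) ((p : ℤ) ^ j)) (ℓ + n)),
      f'loc (ℓ + n) n y = 0 ↔ ∃ x, f'loc ℓ (ℓ + n) x = y := by
    intro ℓ n y
    simp only [hf'loc, ← hfloc]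
    exact hex ℓ n y
  -- injectivity of the plain divisions (a basis of `E_K[p^k]`)
  have hinj : ∀ ℓ n, Function.Injective (floc ℓ (ℓ + n)) := fun ℓ n ↦
    κ.eisensteinTwistTransfer_injective_of_le (fun k ↦ (W.baseChange K).torsionGaloisModule ((p : ℤ) ^ k))
      (fun j ↦ (W.baseChange K).torsionGaloisModuleReduce p j) hm _ _ _
      (fun k ↦ ((W.baseChange K).nonempty_geomTorsion_prime_pow_addEquiv_fin_two hpK k).some) ℓ n
  have hontov : ∀ ℓ n, ∀ w' ∈ Fil n, ∃ w ∈ Fil (ℓ + n), floc (ℓ + n) n w = w' := fun ℓ n w' hw' ↦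
    (W.baseChange K).exists_mem_twistedFil_transfer_eq_ordinaryFiltrationAt v κ hm
      (fun j ↦ (W.baseChange K).torsionGaloisModuleReduce p j) (fun _ _ ↦ rfl) hgood hpv hord ℓ n w' hw'
  have hsatv : ∀ ℓ n (w : EisensteinLevel p m (fun j ↦ geomTorsion (W.baseChange K) ((p : ℤ) ^ j)) ℓ),
      floc ℓ (ℓ + n) w ∈ Fil (ℓ + n) → w ∈ Fil ℓ := fun ℓ n w hw ↦
    (W.baseChange K).mem_twistedFil_of_transfer_mem_ordinaryFiltrationAt v κ hm
      (fun j ↦ (W.baseChange K).torsionGaloisModuleReduce p j) (fun _ _ ↦ rfl) hgood hpv hord ℓ n w hw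
  /- ### C♭. the plain quotient tower `W_a ⧸ Fil_v W_a` (the `G`-tower) and (Ker-tors) at `v` -/
  obtain ⟨q, hq⟩ := Tower.exists_quotFamily_apply_mk ρloc floc Fil hΓ hmapv
  have hinjQ : ∀ ℓ n, Function.Injective (q ℓ (ℓ + n)) := fun ℓ n ↦ Tower.quotFamily_injective hq hsatv ℓ n
  have hsurjQ : ∀ ℓ n, Function.Surjective (q (ℓ + n) n) := fun ℓ n ↦ Tower.quotFamily_surjective hq hsurj ℓ n
  have hexQ : ∀ ℓ n (y : EisensteinLevel p m (fun j ↦ geomTorsion (W.baseChange K) ((p : ℤ) ^ j)) (ℓ + n) ⧸ Fil (ℓ + n)),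
      q (ℓ + n) n y = 0 ↔ ∃ x, q ℓ (ℓ + n) x = y := fun ℓ n y ↦ Tower.quotFamily_exact hq hmapv hex hontov ℓ n y
  let ρG : ∀ a, DiscreteGaloisModule (v.adicCompletion K)
      (EisensteinLevel p m (fun j ↦ geomTorsion (W.baseChange K) ((p : ℤ) ^ j)) a ⧸ Fil a) :=
    fun a ↦ (ρloc a).quotient (Fil a) (hΓ a)
  have hcG : ∀ (d : ℕ) (u : EisensteinLevel p m (fun j ↦ geomTorsion (W.baseChange K) ((p : ℤ) ^ j)) d ⧸ Fil d),
      (∀ g : absoluteGaloisGroup (v.adicCompletion K), ρG d g u = u) → p ^ 1 • u = 0 := by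
    intro d u hu
    have h := ((W.baseChange K).ordinaryFiltrationAt v (fun j ↦ (W.baseChange K).torsionGaloisModuleReduce p j)
      (fun _ _ ↦ rfl)).natCast_smul_eq_zero_of_forall_quotient_apply_eq_self (W.baseChange K) κ hm hg₀ hms d u hu
    rw [pow_one, ← natCast_zsmul]
    exact h
  have hKerT' : ∀ {a b : ℕ} (_ : a ≤ b) (x : galoisCohomology (ρG a) 1), galoisCohomology.map (q a b) 1 x = 0 →
      p ^ 1 • x = 0 := fun hab x hx ↦
    Tower.pow_smul_eq_zero_of_map_eq_zero_of_forall_invariants_of_le ρG q hinjQ hsurjQ hexQ p hcG hab x hx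
  /- ### D♭. the twisted sub-tower `δ_v Fil_{σv} W_a ≤ Tw W_a` (the `F`-tower), `ι′ = H¹(subtype)`, `π = H¹(mkQ)` -/
  obtain ⟨g', hg'⟩ := Tower.exists_subFamily_apply_eq ρ'loc f'loc Fil' hΓ' hmap'
  let ρF : ∀ j, DiscreteGaloisModule (v.adicCompletion K) (Fil' (j + 1)) :=
    fun j ↦ (ρ'loc (j + 1)).subrepresentation (Fil' (j + 1)) (hΓ' (j + 1))
  haveI hfinF : ∀ j, Finite (galoisCohomology (ρF j) 1) := fun j ↦
    finite_galoisCohomology_one_adicCompletion v (ρF j)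
  let redF : ∀ j, galoisCohomology (ρF (j + 1)) 1 →+ galoisCohomology (ρF j) 1 :=
    fun j ↦ galoisCohomology.map (g' (j + 1 + 1) (j + 1)) 1
  let ι : ∀ j, galoisCohomology (ρF j) 1 →+ galoisCohomology ((cd.twist ((W.eisensteinTower κ hm).ρ j)).toLocal (Sum.inr v)) 1 :=
    fun j ↦ (cohomologyMap (subtypeHom (ρ'loc (j + 1)) (Fil' (j + 1)) (hΓ' (j + 1))) 1).hom.toLinearMap.toAddMonoidHom
  have hιdef : ∀ j (f : galoisCohomology (ρF j) 1),
      ι j f = cohomologyMap (subtypeHom (ρ'loc (j + 1)) (Fil' (j + 1)) (hΓ' (j + 1))) 1 f := fun j f ↦ rfl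
  -- the reductions of the twisted `D`-indexed tower are `H¹(f'loc (j+2) (j+1))`
  have hred' : ∀ (j : ℕ) (y : galoisCohomology ((cd.twist ((W.eisensteinTower κ hm).ρ (j + 1))).toLocal (Sum.inr v)) 1),
      ContinuousRep.cohomologyMap ((cd.twist ((W.eisensteinTower κ hm).ρ (j + 1))).toLocal (Sum.inr v))
          ((cd.twist ((W.eisensteinTower κ hm).ρ j)).toLocal (Sum.inr v)) ((W.eisensteinTower κ hm).red j).toAddMonoidHom
          continuous_of_discreteTopology (fun _ z => (W.eisensteinTower κ hm).red_equivariant j _ z) 1 y =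
        galoisCohomology.map (f'loc (j + 1 + 1) (j + 1)) 1 y := by
    intro j y
    have e1 : f'loc (j + 1 + 1) (j + 1) = Literature.NumberTheory.EllipticCurves.DiscreteGaloisModule.localMap
        (Literature.NumberTheory.EllipticCurves.DiscreteGaloisModule.restrictMap
          (κ.eisensteinTwistReduce hm (Nat.le_succ (j + 1)) ((W.baseChange K).torsionGaloisModuleReduce p (j + 1))) cd.conj)
        (Sum.inr v) := by
      change Literature.NumberTheory.EllipticCurves.DiscreteGaloisModule.localMap
        (Literature.NumberTheory.EllipticCurves.DiscreteGaloisModule.restrictMap (κ.eisensteinTwistTransfer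
          (fun k ↦ (W.baseChange K).torsionGaloisModule ((p : ℤ) ^ k))
          (fun j ↦ (W.baseChange K).torsionGaloisModuleReduce p j) hm _ _ _ (j + 1 + 1) (j + 1)) cd.conj) (Sum.inr v) = _
      rw [κ.eisensteinTwistTransfer_succ_self]
    rw [e1]
    rfl
  have hι : ∀ (j : ℕ) (f : galoisCohomology (ρF (j + 1)) 1),
      ContinuousRep.cohomologyMap ((cd.twist ((W.eisensteinTower κ hm).ρ (j + 1))).toLocal (Sum.inr v))
          ((cd.twist ((W.eisensteinTower κ hm).ρ j)).toLocal (Sum.inr v)) ((W.eisensteinTower κ hm).red j).toAddMonoidHom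
          continuous_of_discreteTopology (fun _ z => (W.eisensteinTower κ hm).red_equivariant j _ z) 1 (ι (j + 1) f) =
        ι j (redF j f) := by
    intro j f
    rw [hred', hιdef, hιdef]
    exact Tower.map_subtypeHom_eq_subtypeHom_map (ρ := ρ'loc) (f := f'loc) (Fil := Fil') (hΓ := hΓ') hg'
      (j + 1 + 1) (j + 1) f
  have hC : ∀ (j : ℕ) (f : galoisCohomology (ρF j) 1),
      ι j f ∈ (((W.baseChange K).ordinaryFiltrationAt (cd.σ • v)
          (fun j ↦ (W.baseChange K).torsionGaloisModuleReduce p j) (fun _ _ ↦ rfl)).ordinaryCore hm (j + 1)).map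
        (cd.transportH1 (κ.eisensteinTwist ((W.baseChange K).torsionGaloisModule ((p : ℤ) ^ (j + 1))) hm (j + 1)) v) := by
    intro j f
    have h2 : ι j f ∈ (ρ'loc (j + 1)).strictSubgroup (Fil' (j + 1)) (hΓ' (j + 1)) :=
      (Tower.mem_strictSubgroup_iff_exists_map_subtypeHom_eq (ρ := ρ'loc) (Fil := Fil') (hΓ := hΓ') (j + 1) _).2 ⟨f, rfl⟩
    exact (cd.map_transportH1_strictSubgroup_eq (κ.eisensteinTwist ((W.baseChange K).torsionGaloisModule
      ((p : ℤ) ^ (j + 1))) hm (j + 1)) v (Filσ (j + 1))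
      (fun g ↦ ((W.baseChange K).ordinaryFiltrationAt (cd.σ • v) (fun j ↦ (W.baseChange K).torsionGaloisModuleReduce p j)
        (fun _ _ ↦ rfl)).twistedFil_le_comap (κ := κ) hm (j + 1) g) (hΓ' (j + 1))).ge h2
  let π' : ∀ j, galoisCohomology (((W.eisensteinTower κ hm).ρ j).toLocal (Sum.inr v)) 1 →+ galoisCohomology (ρG (j + 1)) 1 :=
    fun j ↦ (ρloc (j + 1)).quotientMap (Fil (j + 1)) (hΓ (j + 1)) 1
  have hC' : ∀ (j : ℕ) (x : galoisCohomology (((W.eisensteinTower κ hm).ρ j).toLocal (Sum.inr v)) 1),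
      π' j x = 0 → x ∈ ((W.baseChange K).ordinaryFiltrationAt v (fun j ↦ (W.baseChange K).torsionGaloisModuleReduce p j)
        (fun _ _ ↦ rfl)).ordinaryCore hm (j + 1) := fun j x hx ↦ hx
  let upG : ∀ k d : ℕ, galoisCohomology (ρG k.succ) 1 →+ galoisCohomology (ρG (k + d).succ) 1 :=
    fun k d ↦ galoisCohomology.map (q (k + 1) (k + d + 1)) 1
  have hKerT : ∀ (k d : ℕ) (x : galoisCohomology (ρG (k + 1)) 1), upG k d x = 0 → p ^ 1 • x = 0 :=
    fun k d x hx ↦ hKerT' (show k + 1 ≤ k + d + 1 by omega) x hx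
  /- ### E♭. the flipped restricted pairings as bi-additive maps, (proj), (Adj′), (Nondeg′) -/
  let Pa : ∀ j, galoisCohomology (ρF j) 1 →+ galoisCohomology (ρG (j + 1)) 1 →+
      galoisCohomology ((D j).twistOne.toLocal (Sum.inr v)) 2 := fun j ↦
    AddMonoidHom.mk' (fun f ↦ AddMonoidHom.mk' (fun y ↦ (P j).cupProduct y f) fun y y' ↦
        DFunLike.congr_fun (map_add (P j).cupProduct y y') f)
      fun f f' ↦ AddMonoidHom.ext fun y ↦ map_add ((P j).cupProduct y) f f'
  have hPa : ∀ j (f : galoisCohomology (ρF j) 1) (y : galoisCohomology (ρG (j + 1)) 1),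
      Pa j f y = (P j).cupProduct y f := fun j f y ↦ rfl
  have hproj : ∀ (j : ℕ) (f : galoisCohomology (ρF j) 1)
      (x : galoisCohomology (((W.eisensteinTower κ hm).ρ j).toLocal (Sum.inr v)) 1),
      ((D j).localCup (Sum.inr v)).flip (ι j f) x = Pa j f (π' j x) := by
    intro j f x
    haveI : CompactSpace (absoluteGaloisGroup (Place.Completion (Sum.inr v))) :=
      inferInstanceAs (CompactSpace (absoluteGaloisGroup (v.adicCompletion K)))
    haveI : LocallyCompactSpace (absoluteGaloisGroup (Place.Completion (Sum.inr v))) :=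
      inferInstanceAs (LocallyCompactSpace (absoluteGaloisGroup (v.adicCompletion K)))
    have h := ContPairing.cupProduct_adjoint ((D j).ePairingLocal (Sum.inr v)) (P j)
      ((ρloc (j + 1)).mkQHom (Fil (j + 1)) (hΓ (j + 1))) (subtypeHom (ρ'loc (j + 1)) (Fil' (j + 1)) (hΓ' (j + 1)))
      (fun s t ↦ hP j s t) x f
    exact h.symm
  -- value maps `ι_d : A_{m,k+1} → A_{m,k+d+1}` and `incQ := H²(ι_d(1))`
  have hιv := fun k ↦ IwasawaAlgebra.EisensteinCoeff.exists_forall_addMonoidHom_apply_reduce_eq_pow_smul (p := p) m k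
  choose ιv hιv using hιv
  let incQ : ∀ k d : ℕ, galoisCohomology ((D k).twistOne.toLocal (Sum.inr v)) 2 →+
      galoisCohomology ((D (k + d)).twistOne.toLocal (Sum.inr v)) 2 := fun k d ↦
    ContinuousRep.cohomologyMap (GaloisRep.toLocal v (D k).twistOne) (GaloisRep.toLocal v (D (k + d)).twistOne) (ιv k d)
      continuous_of_discreteTopology
      (fun _ z => (D k).twistOne_apply_of_apply_reduce (D (k + d)) _ (ιv k d) (p ^ d) (hιv k d) _ z) 2
  -- the twisted sub-tower's iterated reductions are `H¹(g' (k+d+1) (k+1))`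
  have hid' : ∀ a (x : EisensteinLevel p m (fun j ↦ geomTorsion (W.baseChange K) ((p : ℤ) ^ j)) a), f'loc a a x = x :=
    fun a x ↦ by rw [hf'loc, ← hfloc]; exact hid a x
  have hcomp' : ∀ a b c', c' ≤ b → b ≤ a →
      ∀ x : EisensteinLevel p m (fun j ↦ geomTorsion (W.baseChange K) ((p : ℤ) ^ j)) a, f'loc b c' (f'loc a b x) = f'loc a c' x :=
    fun a b c' hcb hba x ↦ by rw [hf'loc, hf'loc, hf'loc, ← hfloc, ← hfloc, ← hfloc]; exact hcomp a b c' hcb hba x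
  have hidF : ∀ a (x : Fil' (a + 1)), g' (a + 1) (a + 1) x = x := fun a x ↦ Tower.subFamily_id hg' hid' (a + 1) x
  have hcompF : ∀ a b c', c' ≤ b → b ≤ a → ∀ x : Fil' (a + 1),
      g' (b + 1) (c' + 1) (g' (a + 1) (b + 1) x) = g' (a + 1) (c' + 1) x :=
    fun a b c' hcb hba x ↦ Tower.subFamily_comp hg' hcomp' (a + 1) (b + 1) (c' + 1) (by omega) (by omega) x
  have hredIter : ∀ (k d : ℕ) (w : galoisCohomology (ρF (k + d)) 1),
      Tower.redIter (H := fun j ↦ galoisCohomology (ρF j) 1) redF k d w = galoisCohomology.map (g' (k + d + 1) (k + 1)) 1 w :=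
    fun k d w ↦ Tower.redIter_eq_map (ρ := fun j ↦ ρF j) (f := fun a b ↦ g' (a + 1) (b + 1)) hidF hcompF k d w
  have hAdj : ∀ (k d : ℕ) (w : galoisCohomology (ρF (k + d)) 1) (y : galoisCohomology (ρG (k + 1)) 1),
      incQ k d (Pa k (Tower.redIter (H := fun j ↦ galoisCohomology (ρF j) 1) redF k d w) y) = Pa (k + d) w (upG k d y) := by
    intro k d w y
    rw [hredIter, hPa, hPa]
    exact W.eisensteinTower_restrictedPairing_flip_cupProduct_adjoint' κ hm cd D he_red v k d (ιv k d) (hιv k d)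
      (P k) (hP k) (P (k + d)) (hP (k + d)) (q (k + 1) (k + d + 1)) (fun s' ↦ hq _ _ s')
      (g' (k + d + 1) (k + 1))
      (fun t' ↦ ((hg' _ _ t').trans (hf'loc _ _ _)).trans
        (W.eisensteinTower_redIter_eq_eisensteinTwistTorsionTransfer κ hm k d _).symm) y w
  have hNondeg : ∀ (k d : ℕ) (y : galoisCohomology (ρG (k + d + 1)) 1),
      (∀ w : galoisCohomology (ρF (k + d)) 1, Pa (k + d) w y = 0) → y = 0 :=
    fun k d y hy ↦ hPnd (k + d) y fun x ↦ hy x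
  /- ### F♭. assembly (roles of the two towers exchanged, pairing `B_j.flip`) -/
  exact Tower.mem_saturatedFamilies_of_forall_saturated_pairing_eq_zero_of_ker_torsion
    (X := fun j ↦ galoisCohomology ((cd.twist ((W.eisensteinTower κ hm).ρ j)).toLocal (Sum.inr v)) 1)
    (Y := fun j ↦ galoisCohomology (((W.eisensteinTower κ hm).ρ j).toLocal (Sum.inr v)) 1)
    (Q := fun j ↦ galoisCohomology ((D j).twistOne.toLocal (Sum.inr v)) 2)
    (F := fun j ↦ galoisCohomology (ρF j) 1) (G := fun j ↦ galoisCohomology (ρG (j + 1)) 1)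
    (fun j ↦ ContinuousRep.cohomologyMap ((cd.twist ((W.eisensteinTower κ hm).ρ (j + 1))).toLocal (Sum.inr v))
      ((cd.twist ((W.eisensteinTower κ hm).ρ j)).toLocal (Sum.inr v)) ((W.eisensteinTower κ hm).red j).toAddMonoidHom
      continuous_of_discreteTopology (fun _ z => (W.eisensteinTower κ hm).red_equivariant j _ z) 1)
    (fun j ↦ ((D j).localCup (Sum.inr v)).flip)
    (fun j ↦ ContinuousRep.cohomologyMap (((W.eisensteinTower κ hm).ρ (j + 1)).toLocal (Sum.inr v))
      (((W.eisensteinTower κ hm).ρ j).toLocal (Sum.inr v)) ((W.eisensteinTower κ hm).red j).toAddMonoidHom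
      continuous_of_discreteTopology (fun _ z => (W.eisensteinTower κ hm).red_equivariant j _ z) 1)
    redF Pa ι π' p _ _ hι hC hproj hC' upG incQ hAdj hNondeg hKerT hξ fun j η hη ↦ h0 j η hη

end WeierstrassCurve

end
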